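import Summits.Ventures.PercRepro.RankLevelSetRuleQSliceMapRecord
import Summits.Ventures.PercRepro.RankLevelSetRuleQSliceBand

/-!
# PercRepro — THE MAP OF RULE Q ON EVERY FAMILY `k ≥ 5`: THE STATEMENT OF RECORD, SECOND EDITION (night-1, gen 22; dossier §33)

`ruleQ_slice_map_of_record` (gen 21) with the bottom-regime clauses replaced by the whole slices and the square-root band added:
for every family `k ≥ 5`, at the tight layer,
* the slices `u ≤ 1` are paid on every cell; the slices `2 ≤ u ≤ k − 3` are NOT paid on every cell (an unpaid member on
  some finite matroid at every `q ≥ 4^{k+3} + u`);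
* the borderline `u = k − 2`, the first untruncated slice `u = k − 1` and the second `u = k` are paid on EVERY cell;
* every slice `u ≥ k − 1` with `4(u+k)² ≤ q − u` is paid (the square-root band).
Arithmetic level `ruleQ_slice_map_of_record_two`, matroid level `ruleQ_slice_map_of_record_two_matroid`. Axioms: standard.
-/

namespace PercRepro

open Set Matroid Finset

/-- **THE MAP OF RULE Q ON THE FAMILY `k ≥ 5`, SECOND EDITION** (arithmetic level). -/
theorem ruleQ_slice_map_of_record_two (k : ℕ) (hk : 5 ≤ k) :
    (∀ u, u ≤ 1 → ∀ q, u ≤ q → phiK (q + k) q ≤ rhat q k (q - u))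
    ∧ (∀ u, 2 ≤ u → u + 3 ≤ k → ¬ ∀ q, u ≤ q → phiK (q + k) q ≤ rhat q k (q - u))
    ∧ (∀ q, k - 2 ≤ q → phiK (q + k) q ≤ rhat q k (q - (k - 2)))
    ∧ (∀ q, k - 1 ≤ q → phiK (q + k) q ≤ rhat q k (q - (k - 1)))
    ∧ (∀ q, k ≤ q → phiK (q + k) q ≤ rhat q k (q - k))
    ∧ (∀ u q, k - 1 ≤ u → u ≤ q → 4 * (u + k) ^ 2 ≤ q - u → phiK (q + k) q ≤ rhat q k (q - u)) := by
  obtain ⟨h1, h2, h3, -, -⟩ := ruleQ_slice_map_of_record k hk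
  exact ⟨h1, h2, h3, fun q hq => first_untrunc_slice_every k q hk hq,
    fun q hq => second_untrunc_slice_every k q hk hq,
    fun u q hu huq hm => slice_band k u q hk hu huq hm⟩

/-- **THE MAP AT THE MATROID LEVEL, SECOND EDITION**: at the tight layer of every finite matroid, for every family `k ≥ 5` —
the members with `#P ≥ q − 1`, with `#P = q − (k−2)`, with `#P = q − (k−1)`, with `#P = q − k`, and every member at distance
`u ≥ k − 1` with `4(u+k)² ≤ q − u` from the top are paid by Rule Q's equal split; and for every `2 ≤ u ≤ k − 3` some member at
distance `u` is not. -/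
theorem ruleQ_slice_map_of_record_two_matroid (k : ℕ) (hk : 5 ≤ k) :
    (∀ (β : Type) (M : Matroid β) (hf : M.Finite) (q : ℕ), M.E.ncard = (q + k) + q →
        ∀ Z ∈ cellMembers M (q + k) q, q ≤ (flatPart M Z).ncard + 1 → phiK (q + k) q ≤ @ruleQRecv β M hf (q + k) q Z)
    ∧ (∀ u, 2 ≤ u → u + 3 ≤ k → ∀ q, 4 ^ (k + 3) + u ≤ q →
        ∃ (β : Type) (M : Matroid β) (hf : M.Finite) (Z : Set β), M.E.ncard = (q + k) + q ∧ Z ∈ cellMembers M (q + k) q ∧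
          (flatPart M Z).ncard = q - u ∧ @ruleQRecv β M hf (q + k) q Z < phiK (q + k) q)
    ∧ (∀ (β : Type) (M : Matroid β) (hf : M.Finite) (q : ℕ), k - 2 ≤ q → M.E.ncard = (q + k) + q →
        ∀ Z ∈ cellMembers M (q + k) q, (flatPart M Z).ncard = q - (k - 2) → phiK (q + k) q ≤ @ruleQRecv β M hf (q + k) q Z)
    ∧ (∀ (β : Type) (M : Matroid β) (hf : M.Finite) (q : ℕ), k - 1 ≤ q → M.E.ncard = (q + k) + q →
        ∀ Z ∈ cellMembers M (q + k) q, (flatPart M Z).ncard = q - (k - 1) → phiK (q + k) q ≤ @ruleQRecv β M hf (q + k) q Z)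
    ∧ (∀ (β : Type) (M : Matroid β) (hf : M.Finite) (q : ℕ), k ≤ q → M.E.ncard = (q + k) + q →
        ∀ Z ∈ cellMembers M (q + k) q, (flatPart M Z).ncard = q - k → phiK (q + k) q ≤ @ruleQRecv β M hf (q + k) q Z)
    ∧ (∀ (β : Type) (M : Matroid β) (hf : M.Finite) (q u : ℕ), k - 1 ≤ u → u ≤ q → 4 * (u + k) ^ 2 ≤ q - u →
        M.E.ncard = (q + k) + q →
        ∀ Z ∈ cellMembers M (q + k) q, (flatPart M Z).ncard = q - u → phiK (q + k) q ≤ @ruleQRecv β M hf (q + k) q Z) := by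
  obtain ⟨h1, h2, h3, -, -⟩ := ruleQ_slice_map_of_record_matroid k hk
  exact ⟨h1, h2, h3,
    fun β M hf q hq hE Z hZ hP => @ruleQRecv_ge_phiK_first_untrunc_every β M hf q k hk hq hE Z hZ hP,
    fun β M hf q hq hE Z hZ hP => @ruleQRecv_ge_phiK_second_untrunc_every β M hf q k hk hq hE Z hZ hP,
    fun β M hf q u hu huq hm hE Z hZ hP => @ruleQRecv_ge_phiK_band β M hf q k u hk hu huq hm hE Z hZ hP⟩

end PercRepro
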